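import Summits.Ventures.LatticeQCDFlow.Scaling.HubClassStartContentDeficitEnum

/-!
HONEST FRAMING: exact (Metropolis-corrected) sampling algorithms for lattice gauge theory; figures
of merit are autocorrelation/cost numbers at stated couplings and volumes; no continuum-physics
claim.

# HubClassStartContentResidualGEnum — THE SIGNED `g`-FORM OF THE RESIDUAL PAIR'S START-CONTENT DEFICIT IN CHAPTER W'S LANGUAGE (COMMON SORTED ENUMERATION, TAG AT RANK 0, HUB ALONE
# AT RANK 1): `e_n ≤ K^{−n}(g_n(W_z/W^Y_t) − g_n(W_z/W^X_t))`, `g_n(u) = (−u − (−u)^{n+1})/(1+u)` (lean-2 GEN-42, ours)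

Venture-side (OURS).  Cell `lqcd-flow` (pub-lqcd), unit `pub-lqcd-lean-2-g42`, 2026-08-30.  Chapter AB (route (β), the cost side continued), file 14 — a typed tool for the one
configuration left after file 13 (the lone hub strictly between the extra particles, memo MEMO-gen42 §5).  GEN-41 file 5 (B) exported only the integrated forms
(`e_{n+1} ≤ 𝟙{n odd}K^{−(n+1)}α/(1+α)` and the discounted sum) of GEN-41 file 2; the SIGNED form `e_n ≤ cⁿ(g_n(α_Y) − g_n(α_X))` (`residual_deficit_le_g`) — negative at odd `n`
(`−cⁿ(1−α^{n+1})/(1+α)` when `α_Y = 1`) — is what the signed sum `e^{XY} = e^{XZ} + e^{ZY}` through the tag position at `W_z` needs, since the odd-attempt deficits of the lower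
half-move are compensated by it.  Hypotheses verbatim as GEN-41 file 5 ∕ file 3 of this chapter; ranks `s = 0` (tag), `i = 1` (hub), `N(z) = 1`.

* **`hubClass_startClass_residual_g_of_enum`**: `Kh_Yⁿ(N;z,z) − Kh_Xⁿ(N;z,z) ≤ (1/K)ⁿ·(g_n(W_z/W^Y_t) − g_n(W_z/W^X_t))` for every `n` (GEN-41 file 2 `residual_deficit_le_g` through Y12's dictionary,
  plumbing verbatim from GEN-41 file 5).

Literature grade (cell rule): OWN, plumbing; nothing cited; no new bib keys.
-/

open Finset

namespace Summit.Ventures.LatticeQCDFlow.Scaling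

section RecursionEnum
variable {S : Type*} [Fintype S] [DecidableEq S]

/-- **The signed `g`-form of the residual pair's start-content deficit given a common sorted enumeration and the ranks** (see the module docstring). [ours] -/
theorem hubClass_startClass_residual_g_of_enum {WX WY : S → ℝ} {accX accY : S → S → ℝ} {KhX KhY : (S → ℕ) → S → S → ℝ} {K : ℕ} {N : S → ℕ} {t z : S}
    {KhnX KhnY : ℕ → S → S → ℝ} {e : ℕ → S} {m i s : ℕ}
    (hWX : ∀ v, 0 < WX v) (hWY : ∀ v, 0 < WY v) (hagree : ∀ v, v ≠ t → WX v = WY v) (hWt : WY t ≤ WX t)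
    (haccX : ∀ h v, accX h v = min 1 (WX h / WX v)) (haccY : ∀ h v, accY h v = min 1 (WY h / WY v)) (hK : 2 ≤ K)
    (hNK : ∑ v, (N v : ℝ) = K + 1) (hNt : N t = 1)
    (hKXoff : ∀ N' h v, h ≠ v → KhX N' h v = if N' h = 0 then 0 else (N' v : ℝ) / K * accX h v)
    (hKXdiag : ∀ N' h, KhX N' h h = 1 - ∑ v ∈ univ.erase h, KhX N' h v)
    (hKYoff : ∀ N' h v, h ≠ v → KhY N' h v = if N' h = 0 then 0 else (N' v : ℝ) / K * accY h v)
    (hKYdiag : ∀ N' h, KhY N' h h = 1 - ∑ v ∈ univ.erase h, KhY N' h v)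
    (hKhnX0 : ∀ h v, KhnX 0 h v = if h = v then 1 else 0) (hKhnXs : ∀ n h v, KhnX (n + 1) h v = ∑ w, KhnX n h w * KhX N w v)
    (hKhnY0 : ∀ h v, KhnY 0 h v = if h = v then 1 else 0) (hKhnYs : ∀ n h v, KhnY (n + 1) h v = ∑ w, KhnY n h w * KhY N w v)
    (he_inj : ∀ i j, i < m → j < m → e i = e j → i = j) (he_pres : ∀ i, i < m → N (e i) ≠ 0) (he_cov : ∀ v, N v ≠ 0 → ∃ i, i < m ∧ e i = v)
    (hsortX : ∀ i j, i ≤ j → j < m → WX (e j) ≤ WX (e i)) (hsortY : ∀ i j, i ≤ j → j < m → WY (e j) ≤ WY (e i))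
    (hi : i < m) (hs : s < m) (hiz : e i = z) (hst : e s = t)
    (hsi : s < i) (hs0 : s = 0) (hi1 : i = 1) (hNz : N z = 1) (n : ℕ) :
    KhnY n z z - KhnX n z z
      ≤ (1 / (K : ℝ)) ^ n * (((-(WX z / WY t) - (-(WX z / WY t)) ^ (n + 1)) / (1 + WX z / WY t))
          - ((-(WX z / WX t) - (-(WX z / WX t)) ^ (n + 1)) / (1 + WX z / WX t))) := by
  classical
  have his : i ≠ s := ne_of_gt hsi
  subst hiz; subst hst
  have hNt0 : N (e s) ≠ 0 := by rw [hNt]; exact one_ne_zero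
  have hK1 : 1 ≤ K := by omega
  have hWXY : ∀ v, WY v ≤ WX v := fun v => by
    by_cases hv : v = e s
    · rw [hv]; exact hWt
    · rw [hagree v hv]
  have het : ∀ l, l < m → l ≠ s → e l ≠ e s := fun l hl hls h => hls (he_inj l s hl hs h)
  -- the `ℕ`-indexed data (verbatim from Z11)
  obtain ⟨c, hc⟩ : ∃ c : ℝ, c = 1 / K := ⟨_, rfl⟩
  obtain ⟨ρX, hρX⟩ : ∃ ρX : ℕ → ℝ, ∀ l, ρX l = if l < m then 1 / WX (e l) else 1 / WY (e (m - 1)) := ⟨_, fun _ => rfl⟩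
  obtain ⟨ρY, hρY⟩ : ∃ ρY : ℕ → ℝ, ∀ l, ρY l = if l < m then 1 / WY (e l) else 1 / WY (e (m - 1)) := ⟨_, fun _ => rfl⟩
  obtain ⟨Nn, hNn⟩ : ∃ Nn : ℕ → ℝ, ∀ l, Nn l = if l < m then (N (e l) : ℝ) else 1 := ⟨_, fun _ => rfl⟩
  obtain ⟨RX, hRX⟩ : ∃ RX : ℕ → ℝ, ∀ k, RX k = ∑ i ∈ range k, Nn i * ρX i := ⟨_, fun _ => rfl⟩
  obtain ⟨RY, hRY⟩ : ∃ RY : ℕ → ℝ, ∀ k, RY k = ∑ i ∈ range k, Nn i * ρY i := ⟨_, fun _ => rfl⟩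
  obtain ⟨M, hM⟩ : ∃ M : ℕ → ℝ, ∀ k, M k = ∑ i ∈ Ico k m, Nn i := ⟨_, fun _ => rfl⟩
  obtain ⟨βX, hβX⟩ : ∃ βX : ℕ → ℝ, ∀ k, βX k = 1 - c * (M k + RX k / ρX k) := ⟨_, fun _ => rfl⟩
  obtain ⟨βY, hβY⟩ : ∃ βY : ℕ → ℝ, ∀ k, βY k = 1 - c * (M k + RY k / ρY k) := ⟨_, fun _ => rfl⟩
  obtain ⟨a, ha⟩ : ∃ a : ℕ → ℝ, ∀ l, a l = 1 - c * M (l + 1) := ⟨_, fun _ => rfl⟩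
  obtain ⟨TX, hTX⟩ : ∃ TX : ℕ → ℕ → ℝ, ∀ n j, TX n j = (1 - βX j ^ n) / RX m + ∑ k ∈ Ico (j + 1) m, (1 / RX k - 1 / RX (k + 1)) * (βX k ^ n - βX j ^ n) :=
    ⟨_, fun _ _ => rfl⟩
  obtain ⟨TY, hTY⟩ : ∃ TY : ℕ → ℕ → ℝ, ∀ n j, TY n j = (1 - βY j ^ n) / RY m + ∑ k ∈ Ico (j + 1) m, (1 / RY k - 1 / RY (k + 1)) * (βY k ^ n - βY j ^ n) :=
    ⟨_, fun _ _ => rfl⟩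
  obtain ⟨fX, hfX⟩ : ∃ fX : ℕ → ℕ → ℝ, ∀ k i, fX k i = if i < k then ρX k else if i = k then -(RX k / Nn k) else 0 := ⟨_, fun _ _ => rfl⟩
  obtain ⟨fY, hfY⟩ : ∃ fY : ℕ → ℕ → ℝ, ∀ k i, fY k i = if i < k then ρY k else if i = k then -(RY k / Nn k) else 0 := ⟨_, fun _ _ => rfl⟩
  obtain ⟨offX, hoffX⟩ : ∃ off : ℕ → ℕ → ℝ, ∀ i j, off i j = c * Nn j * min 1 (ρX j / ρX i) := ⟨_, fun _ _ => rfl⟩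
  obtain ⟨offY, hoffY⟩ : ∃ off : ℕ → ℕ → ℝ, ∀ i j, off i j = c * Nn j * min 1 (ρY j / ρY i) := ⟨_, fun _ _ => rfl⟩
  obtain ⟨PX, hPX⟩ : ∃ P : ℕ → ℕ → ℝ, ∀ i j, P i j = if i = j then 1 - ∑ l ∈ (range m).erase i, offX i l else offX i j := ⟨_, fun _ _ => rfl⟩
  obtain ⟨PY, hPY⟩ : ∃ P : ℕ → ℕ → ℝ, ∀ i j, P i j = if i = j then 1 - ∑ l ∈ (range m).erase i, offY i l else offY i j := ⟨_, fun _ _ => rfl⟩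
  have hPXoff : ∀ i j, i ≠ j → PX i j = c * Nn j * min 1 (ρX j / ρX i) := fun i j h => by rw [hPX, if_neg h, hoffX]
  have hPYoff : ∀ i j, i ≠ j → PY i j = c * Nn j * min 1 (ρY j / ρY i) := fun i j h => by rw [hPY, if_neg h, hoffY]
  have hPXdiag : ∀ i, PX i i = 1 - ∑ j ∈ (range m).erase i, PX i j := fun i => by
    rw [hPX, if_pos rfl]; congr 1; exact sum_congr rfl fun j hj => by rw [hPX, if_neg (ne_of_mem_erase hj).symm]
  have hPYdiag : ∀ i, PY i i = 1 - ∑ j ∈ (range m).erase i, PY i j := fun i => by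
    rw [hPY, if_pos rfl]; congr 1; exact sum_congr rfl fun j hj => by rw [hPY, if_neg (ne_of_mem_erase hj).symm]
  let PnX : ℕ → ℕ → ℕ → ℝ := fun n => Nat.rec (motive := fun _ => ℕ → ℕ → ℝ) (fun i j => if i = j then 1 else 0) (fun _ prev i j => ∑ l ∈ range m, prev i l * PX l j) n
  let PnY : ℕ → ℕ → ℕ → ℝ := fun n => Nat.rec (motive := fun _ => ℕ → ℕ → ℝ) (fun i j => if i = j then 1 else 0) (fun _ prev i j => ∑ l ∈ range m, prev i l * PY l j) n
  have hPX0 : ∀ i j, PnX 0 i j = if i = j then 1 else 0 := fun _ _ => rfl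
  have hPXs : ∀ n i j, PnX (n + 1) i j = ∑ l ∈ range m, PnX n i l * PX l j := fun _ _ _ => rfl
  have hPY0 : ∀ i j, PnY 0 i j = if i = j then 1 else 0 := fun _ _ => rfl
  have hPYs : ∀ n i j, PnY (n + 1) i j = ∑ l ∈ range m, PnY n i l * PY l j := fun _ _ _ => rfl
  -- elementary facts (verbatim from Z11)
  have hρXpos : ∀ l, 0 < ρX l := fun l => by rw [hρX]; split_ifs <;> exact one_div_pos.mpr (by first | exact hWX _ | exact hWY _)
  have hρYpos : ∀ l, 0 < ρY l := fun l => by rw [hρY]; split_ifs <;> exact one_div_pos.mpr (hWY _)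
  have hNnpos : ∀ l, 0 < Nn l := fun l => by
    rw [hNn]; split_ifs with h
    · exact_mod_cast Nat.pos_of_ne_zero (he_pres l h)
    · exact one_pos
  have hNn1 : ∀ l, 1 ≤ Nn l := fun l => by
    rw [hNn]; split_ifs with h
    · exact_mod_cast Nat.one_le_iff_ne_zero.mpr (he_pres l h)
    · exact le_rfl
  have hmonoX : Monotone ρX := by
    intro l l' hll'
    rw [hρX, hρX]
    by_cases hl' : l' < m
    · rw [if_pos hl', if_pos (by omega : l < m)]; exact one_div_le_one_div_of_le (hWX _) (hsortX l l' hll' hl')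
    · rw [if_neg hl']
      by_cases hl : l < m
      · rw [if_pos hl]; exact one_div_le_one_div_of_le (hWY _) ((hWXY _).trans (hsortX l (m - 1) (by omega) (by omega)))
      · rw [if_neg hl]
  have hmonoY : Monotone ρY := by
    intro l l' hll'
    rw [hρY, hρY]
    by_cases hl' : l' < m
    · rw [if_pos hl', if_pos (by omega : l < m)]; exact one_div_le_one_div_of_le (hWY _) (hsortY l l' hll' hl')
    · rw [if_neg hl']
      by_cases hl : l < m
      · rw [if_pos hl]; exact one_div_le_one_div_of_le (hWY _) (hsortY l (m - 1) (by omega) (by omega))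
      · rw [if_neg hl]
  have hagree' : ∀ l, l ≠ s → ρX l = ρY l := by
    intro l hls
    rw [hρX, hρY]
    by_cases hl : l < m
    · rw [if_pos hl, if_pos hl, hagree (e l) (het l hl hls)]
    · rw [if_neg hl, if_neg hl]
  have htag' : ρX s ≤ ρY s := by
    rw [hρX, hρY, if_pos hs, if_pos hs]; exact one_div_le_one_div_of_le (hWY _) hWt
  have hKpos : (0 : ℝ) < K := by exact_mod_cast (show 0 < K by omega)
  have hcpos : 0 < c := by rw [hc]; positivity
  have hc1 : c ≤ 1 := by rw [hc, div_le_one hKpos]; exact_mod_cast hK1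
  have hM0 : M 0 = ∑ v, (N v : ℝ) := by
    rw [hM, dict_sum_present he_inj he_cov (F := fun v => (N v : ℝ)) (fun v hv => by simp [hv])]
    refine sum_congr (by ext l; simp) fun l hl => ?_
    rw [hNn, if_pos (mem_range.mp hl)]
  have hcK : c * M 0 = 1 + c := by rw [hM0, hNK, hc]; field_simp
  -- the kernel link on the ranks `< m` (verbatim from Z11)
  have hlinkX : ∀ l j, l < m → j < m → KhX N (e l) (e j) = PX l j := by
    intro l j hl hj
    by_cases hlj : l = j
    · subst hlj
      rw [dict_Kh_diag hKXoff hKXdiag he_inj he_pres he_cov hl, hPXdiag]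
      congr 1
      refine sum_congr rfl fun j hj' => ?_
      have hjm : j < m := mem_range.mp (mem_of_mem_erase hj')
      rw [dict_Kh_offdiag hWX haccX hKXoff he_inj he_pres hl hjm (ne_of_mem_erase hj').symm, hPXoff l j (ne_of_mem_erase hj').symm, hNn, if_pos hjm, hρX, hρX, if_pos hjm, if_pos hl, hc]
    · rw [dict_Kh_offdiag hWX haccX hKXoff he_inj he_pres hl hj hlj, hPXoff l j hlj, hNn, if_pos hj, hρX, hρX, if_pos hj, if_pos hl, hc]
  have hlinkY : ∀ l j, l < m → j < m → KhY N (e l) (e j) = PY l j := by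
    intro l j hl hj
    by_cases hlj : l = j
    · subst hlj
      rw [dict_Kh_diag hKYoff hKYdiag he_inj he_pres he_cov hl, hPYdiag]
      congr 1
      refine sum_congr rfl fun j hj' => ?_
      have hjm : j < m := mem_range.mp (mem_of_mem_erase hj')
      rw [dict_Kh_offdiag hWY haccY hKYoff he_inj he_pres hl hjm (ne_of_mem_erase hj').symm, hPYoff l j (ne_of_mem_erase hj').symm, hNn, if_pos hjm, hρY, hρY, if_pos hjm, if_pos hl, hc]
    · rw [dict_Kh_offdiag hWY haccY hKYoff he_inj he_pres hl hj hlj, hPYoff l j hlj, hNn, if_pos hj, hρY, hρY, if_pos hj, if_pos hl, hc]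
  have hpowX : ∀ n l j, l < m → j < m → KhnX n (e l) (e j) = PnX n l j := by
    intro n; induction n with
    | zero =>
        intro l j hl hj
        rw [hKhnX0, hPX0]
        by_cases h : l = j
        · rw [if_pos (by rw [h]), if_pos h]
        · rw [if_neg (fun h' => h (he_inj l j hl hj h')), if_neg h]
    | succ n ih =>
        intro l j hl hj
        rw [dict_Khn_succ hKXoff he_inj he_pres he_cov hKhnX0 hKhnXs n hl hj, hPXs]
        exact sum_congr rfl fun k hk => by rw [ih l k hl (mem_range.mp hk), hlinkX k j (mem_range.mp hk) hj]
  have hpowY : ∀ n l j, l < m → j < m → KhnY n (e l) (e j) = PnY n l j := by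
    intro n; induction n with
    | zero =>
        intro l j hl hj
        rw [hKhnY0, hPY0]
        by_cases h : l = j
        · rw [if_pos (by rw [h]), if_pos h]
        · rw [if_neg (fun h' => h (he_inj l j hl hj h')), if_neg h]
    | succ n ih =>
        intro l j hl hj
        rw [dict_Khn_succ hKYoff he_inj he_pres he_cov hKhnY0 hKhnYs n hl hj, hPYs]
        exact sum_congr rfl fun k hk => by rw [ih l k hl (mem_range.mp hk), hlinkY k j (mem_range.mp hk) hj]
  -- particle counts
  have hMsplit : ∀ k, k < m → M 0 = ∑ l ∈ range (k + 1), Nn l + M (k + 1) := fun k hk => by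
    rw [hM, hM, ← Finset.range_eq_Ico]; exact (Finset.sum_range_add_sum_Ico _ (by omega : k + 1 ≤ m)).symm
  have hcountN : ∀ k, k < m → ∑ l ∈ range (k + 1), Nn l = ∑ l ∈ range (k + 1), (N (e l) : ℝ) := fun k hk =>
    sum_congr rfl fun l hl => by rw [hNn, if_pos (by have := mem_range.mp hl; omega)]
  -- (B): the residual pair `(s,i) = (0,1)`, GEN-41 file 2's signed `g`-form
  subst hs0; subst hi1
  have hN0' : Nn 0 = 1 := by rw [hNn, if_pos hs, hNt]; simp
  have hN1' : Nn 1 = 1 := by rw [hNn, if_pos hi, hNz]; simp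
  have hαX : ρX 0 / ρX 1 = WX (e 1) / WX (e 0) := by
    rw [hρX, hρX, if_pos hs, if_pos hi]
    have h0 := hWX (e 0); have h1 := hWX (e 1)
    field_simp
  have hαY : ρY 0 / ρX 1 = WX (e 1) / WY (e 0) := by
    rw [hρY, hρX, if_pos hs, if_pos hi]
    have h0 := hWY (e 0); have h1 := hWX (e 1)
    field_simp
  obtain ⟨g, hg⟩ : ∃ g : ℕ → ℝ → ℝ, ∀ n t, g n t = (-t - (-t) ^ (n + 1)) / (1 + t) := ⟨_, fun _ _ => rfl⟩
  have h := residual_deficit_le_g hρXpos hmonoX hρYpos hmonoY hagree' htag' hNnpos hNn1 hRX hRY hM hPXoff hPXdiag hPYoff hPYdiag hfX hfY hβX hβY ha hPX0 hPXs hPY0 hPYs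
    hTX hTY hg hcpos.le hcK hN0' hN1' hi n
  rw [hpowY n 1 1 hi hi, hpowX n 1 1 hi hi, ← hαX, ← hαY, ← hc, ← hg, ← hg]
  exact h

end RecursionEnum

end Summit.Ventures.LatticeQCDFlow.Scaling
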